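import Summits.CriticalPhenomena.PercolationContinuityZ3.Theorems.PercNearOneGluingNoHeavyQuantGappedForestLaws
import HarnessLib

/-!
# QUANT lane R8, T-DEC: THE GAPPED TRIPLE `(R¹[q](R³[s]))³` — part 2: the two CAPACITY inequalities of its RESID-DEC certificate in the closed
# form of the residual (`gapped_cap_one`: `R_a(2)·Γ ≤ R_a(9)·(1−Γ)` for `4 < T ≤ 6`; `gapped_cap_two`: `(R_a(2) + R_a(3))·Γ ≤ R_a(9)·(1−Γ)` for
# `T > 6`; `Γ = max(a·x, (T−4)/7)`, `T = aq(3+9s)`, `s ≤ 3/5`) (census-1 gen 24)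

builds on p205010 (kernel theorem, internal audit signed; external expert review pending)

Support file (`--supports stmt-CriticalPhenomena-4575`), QUANT lane seat prim-quant-census-1 (gen 24); memo
`run/shared/lean/prim/quant/prim-quant-census-1/RESID-DEC-G24.md` §6.  Theorems only, standard axioms, no sorries.  Sequel of part 1
(`…QuantGappedForestLaws`: `gapped_I3/I4/I5/I8`); used by part 3 (`…QuantGappedForestSDEC`).  The chains: `(1−q) ≤ (1−aq) ≤ E := (1−aq) + a(1−q)`,
`aq ≤ q`, monotonicity of the capacity in the gate (`a·x ≤ aqs`), and — in the top regime — the nonnegativity of `3s²(1−Γ) − (1−s)²Γ` that lets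
`aq ≤ q` be inserted.

* **`gapped_cap_one`**, **`gapped_cap_two`**.

HONEST STATUS: real inequalities only; `ResidDEC`, `SiblingStep`, `GateStepN`, `FarTreeRow` OPEN; RATE class log\* / honest sentence of
`run/shared/lean/prim/quant/README.md` unchanged.  [this work].
Nothing here is cited as a published result.  The gluing rows served [cite: KozmaNitzan2024, Conjecture 3 (p. 15)]; product measure
[cite: Grimmett1999, §1.3 p. 10].
-/

noncomputable section

open scoped BigOperators

namespace Summit.CriticalPhenomena.PercolationContinuityZ3.Theorems
namespace Quant

open Finset

namespace LawDec

/-! ### The capacity inequalities of the gapped certificate, in the residual's closed form -/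

/-- **capacity, middle regime** (`4 < T ≤ 6`, `T = aq(3+9s)`, gate `Γ = max(a·x, (T−4)/7)`, `a·x ≤ aqs`):
`R_a(2)·Γ ≤ R_a(9)·(1−Γ)` in the closed form of `resid_gapped`. [this work] -/
theorem gapped_cap_one {a q s x : ℝ} (ha0 : 0 < a) (ha1 : a < 1) (hq0 : 0 < q) (hq1 : q < 1) (hs0 : 0 < s) (hs : s ≤ 3 / 5)
    (haq1 : a * q < 1) (hax0 : 0 < a * x) (hax1 : a * x < 1) (hy_le : a * x ≤ a * q * s)
    (hT4 : 4 < (a * q) * (3 + 9 * s)) (hT6 : (a * q) * (3 + 9 * s) ≤ 6) :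
    3 * a * q * (1 - q) * (1 - a * q) * (1 - s) ^ 2 / (2 - q - a * q) * max (a * x) (((a * q) * (3 + 9 * s) - 4) / 7)
      ≤ 3 * a * q ^ 2 * s ^ 2 * (1 - s) * ((1 - a * q) + a * (1 - q)) / (2 - q - a * q)
        * (1 - max (a * x) (((a * q) * (3 + 9 * s) - 4) / 7)) := by
  have hs1 : s < 1 := by linarith
  have hD : 0 < 2 - q - a * q := by nlinarith
  have h1aq : 0 < 1 - a * q := by linarith
  have hE : 0 < (1 - a * q) + a * (1 - q) := by nlinarith
  set Γ : ℝ := max (a * x) (((a * q) * (3 + 9 * s) - 4) / 7) with hΓ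
  have hΓ0 : 0 ≤ Γ := le_trans hax0.le (le_max_left _ _)
  -- (P1): `(1−u)(1−s)·Γ ≤ u s² (1−Γ)` with `u = aq`
  have hP1 : (1 - a * q) * (1 - s) * Γ ≤ (a * q) * s ^ 2 * (1 - Γ) := by
    rcases le_total (a * x) (((a * q) * (3 + 9 * s) - 4) / 7) with hle | hle
    · rw [hΓ, max_eq_right hle]
      have hI := gapped_I4 (a * q) s (mul_pos ha0 hq0) haq1.le hs0 hs hT4 hT6
      have e1 : (1 - a * q) * (1 - s) * (((a * q) * (3 + 9 * s) - 4) / 7) = ((1 - a * q) * (1 - s) * ((a * q) * (3 + 9 * s) - 4)) / 7 := by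
        ring
      have e2 : (a * q) * s ^ 2 * (1 - ((a * q) * (3 + 9 * s) - 4) / 7) = ((a * q) * s ^ 2 * (11 - (a * q) * (3 + 9 * s))) / 7 := by
        ring
      rw [e1, e2]
      linarith
    · rw [hΓ, max_eq_left hle]
      have hI := gapped_I3 (a * q) s hs0 hs hT4
      have hA : 0 ≤ (1 - a * q) * (1 - s) := mul_nonneg h1aq.le (sub_nonneg.2 hs1.le)
      have hB : 0 ≤ (a * q) * s ^ 2 := mul_nonneg (mul_pos ha0 hq0).le (sq_nonneg s)
      have h1 : (1 - a * q) * (1 - s) * (a * x) ≤ (1 - a * q) * (1 - s) * (a * q * s) := mul_le_mul_of_nonneg_left hy_le hA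
      have h2 : (1 - a * q) * (1 - s) * (a * q * s) ≤ (a * q) * s ^ 2 * (1 - a * q * s) := by
        have := mul_le_mul_of_nonneg_left hI (mul_nonneg (mul_pos ha0 hq0).le hs0.le)
        have e1 : (1 - a * q) * (1 - s) * (a * q * s) = a * q * s * ((1 - a * q) * (1 - s)) := by ring
        have e2 : (a * q) * s ^ 2 * (1 - a * q * s) = a * q * s * (s * (1 - a * q * s)) := by ring
        rw [e1, e2]; exact this
      have h3 : (a * q) * s ^ 2 * (1 - a * q * s) ≤ (a * q) * s ^ 2 * (1 - a * x) := mul_le_mul_of_nonneg_left (by linarith) hB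
      linarith
  have hqE : (1 - q) ≤ (1 - a * q) + a * (1 - q) := by nlinarith
  have hqa : a * q ≤ q := by nlinarith
  have key : (1 - q) * (1 - a * q) * (1 - s) * Γ ≤ q * s ^ 2 * ((1 - a * q) + a * (1 - q)) * (1 - Γ) := by
    have hX : 0 ≤ (1 - a * q) * (1 - s) * Γ := mul_nonneg (mul_nonneg h1aq.le (sub_nonneg.2 hs1.le)) hΓ0
    have h1 : (1 - q) * ((1 - a * q) * (1 - s) * Γ) ≤ ((1 - a * q) + a * (1 - q)) * ((1 - a * q) * (1 - s) * Γ) :=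
      mul_le_mul_of_nonneg_right hqE hX
    have h2 : ((1 - a * q) + a * (1 - q)) * ((1 - a * q) * (1 - s) * Γ) ≤ ((1 - a * q) + a * (1 - q)) * ((a * q) * s ^ 2 * (1 - Γ)) :=
      mul_le_mul_of_nonneg_left hP1 hE.le
    have h1Γ : 0 ≤ 1 - Γ := by
      have : Γ ≤ 1 := max_le hax1.le (by rw [div_le_one (by norm_num : (0:ℝ) < 7)]; linarith)
      linarith
    have h3 : ((1 - a * q) + a * (1 - q)) * ((a * q) * s ^ 2 * (1 - Γ)) ≤ ((1 - a * q) + a * (1 - q)) * (q * s ^ 2 * (1 - Γ)) :=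
      mul_le_mul_of_nonneg_left (mul_le_mul_of_nonneg_right (mul_le_mul_of_nonneg_right hqa (sq_nonneg s)) h1Γ) hE.le
    have e1 : (1 - q) * (1 - a * q) * (1 - s) * Γ = (1 - q) * ((1 - a * q) * (1 - s) * Γ) := by ring
    have e2 : q * s ^ 2 * ((1 - a * q) + a * (1 - q)) * (1 - Γ) = ((1 - a * q) + a * (1 - q)) * (q * s ^ 2 * (1 - Γ)) := by ring
    rw [e1, e2]
    linarith
  have hC : 0 ≤ 3 * a * q * (1 - s) / (2 - q - a * q) := div_nonneg (by positivity) hD.le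
  have hmul := mul_le_mul_of_nonneg_left key hC
  calc 3 * a * q * (1 - q) * (1 - a * q) * (1 - s) ^ 2 / (2 - q - a * q) * Γ
      = 3 * a * q * (1 - s) / (2 - q - a * q) * ((1 - q) * (1 - a * q) * (1 - s) * Γ) := by ring
    _ ≤ 3 * a * q * (1 - s) / (2 - q - a * q) * (q * s ^ 2 * ((1 - a * q) + a * (1 - q)) * (1 - Γ)) := hmul
    _ = 3 * a * q ^ 2 * s ^ 2 * (1 - s) * ((1 - a * q) + a * (1 - q)) / (2 - q - a * q) * (1 - Γ) := by ring

/-- **capacity, top regime** (`6 < T`, `T = aq(3+9s) ≤ 42/5`, common gate `Γ = max(a·x, (T−4)/7)`): `(R_a(2) + R_a(3))·Γ ≤ R_a(9)·(1−Γ)` in the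
closed form of `resid_gapped`. [this work] -/
theorem gapped_cap_two {a q s x : ℝ} (ha0 : 0 < a) (ha1 : a < 1) (hq0 : 0 < q) (hq1 : q < 1) (hs0 : 0 < s) (hs : s ≤ 3 / 5)
    (haq1 : a * q < 1) (hax0 : 0 < a * x) (hax1 : a * x < 1) (hy_le : a * x ≤ a * q * s)
    (hT6 : 6 < (a * q) * (3 + 9 * s)) :
    (3 * a * q * (1 - q) * (1 - a * q) * (1 - s) ^ 2 / (2 - q - a * q)
        + a * q ^ 2 * (1 - s) ^ 3 * ((1 - a * q) + a * (1 - q)) / (2 - q - a * q)) * max (a * x) (((a * q) * (3 + 9 * s) - 4) / 7)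
      ≤ 3 * a * q ^ 2 * s ^ 2 * (1 - s) * ((1 - a * q) + a * (1 - q)) / (2 - q - a * q)
        * (1 - max (a * x) (((a * q) * (3 + 9 * s) - 4) / 7)) := by
  have hs1 : s < 1 := by linarith
  have hD : 0 < 2 - q - a * q := by nlinarith
  have h1aq : 0 < 1 - a * q := by linarith
  have hE : 0 < (1 - a * q) + a * (1 - q) := by nlinarith
  have hT84 : (a * q) * (3 + 9 * s) ≤ 42 / 5 := by nlinarith [mul_pos ha0 hq0]
  set Γ : ℝ := max (a * x) (((a * q) * (3 + 9 * s) - 4) / 7) with hΓ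
  have hΓ0 : 0 ≤ Γ := le_trans hax0.le (le_max_left _ _)
  have hΓ1 : Γ ≤ 1 := max_le hax1.le (by rw [div_le_one (by norm_num : (0:ℝ) < 7)]; linarith)
  -- (P): `[3(1−u)(1−s) + u(1−s)²]·Γ ≤ 3us²(1−Γ)` with `u = aq`
  have hP : (3 * (1 - a * q) * (1 - s) + (a * q) * (1 - s) ^ 2) * Γ ≤ 3 * (a * q) * s ^ 2 * (1 - Γ) := by
    rcases le_total (a * x) (((a * q) * (3 + 9 * s) - 4) / 7) with hle | hle
    · rw [hΓ, max_eq_right hle]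
      have hI := gapped_I8 (a * q) s (mul_pos ha0 hq0) haq1.le hs0 hs hT6
      have e1 : (3 * (1 - a * q) * (1 - s) + (a * q) * (1 - s) ^ 2) * (((a * q) * (3 + 9 * s) - 4) / 7)
          = ((3 * (1 - a * q) * (1 - s) + (a * q) * (1 - s) ^ 2) * ((a * q) * (3 + 9 * s) - 4)) / 7 := by ring
      have e2 : 3 * (a * q) * s ^ 2 * (1 - ((a * q) * (3 + 9 * s) - 4) / 7) = (3 * (a * q) * s ^ 2 * (11 - (a * q) * (3 + 9 * s))) / 7 := by
        ring
      rw [e1, e2]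
      linarith
    · rw [hΓ, max_eq_left hle]
      have hI := gapped_I5 (a * q) s (mul_pos ha0 hq0) haq1.le hs hT6
      have hA : 0 ≤ 3 * (1 - a * q) * (1 - s) + (a * q) * (1 - s) ^ 2 := by positivity
      have hB : 0 ≤ 3 * (a * q) * s ^ 2 := by positivity
      have h1 : (3 * (1 - a * q) * (1 - s) + (a * q) * (1 - s) ^ 2) * (a * x)
          ≤ (3 * (1 - a * q) * (1 - s) + (a * q) * (1 - s) ^ 2) * (a * q * s) := mul_le_mul_of_nonneg_left hy_le hA
      have h2 : (3 * (1 - a * q) * (1 - s) + (a * q) * (1 - s) ^ 2) * (a * q * s) ≤ 3 * (a * q) * s ^ 2 * (1 - a * q * s) := by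
        have := mul_le_mul_of_nonneg_left hI (mul_nonneg (mul_pos ha0 hq0).le hs0.le)
        have e1 : (3 * (1 - a * q) * (1 - s) + (a * q) * (1 - s) ^ 2) * (a * q * s)
            = a * q * s * (3 * (1 - a * q) * (1 - s) + (a * q) * (1 - s) ^ 2) := by ring
        have e2 : 3 * (a * q) * s ^ 2 * (1 - a * q * s) = a * q * s * (3 * s * (1 - (a * q) * s)) := by ring
        rw [e1, e2]; exact this
      have h3 : 3 * (a * q) * s ^ 2 * (1 - a * q * s) ≤ 3 * (a * q) * s ^ 2 * (1 - a * x) := mul_le_mul_of_nonneg_left (by linarith) hB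
      linarith
  -- insert `aq ≤ q`: the bracket `3s²(1−Γ) − (1−s)²Γ` is nonnegative by (P)
  have hqa : a * q ≤ q := by nlinarith
  have hB : 0 ≤ 3 * s ^ 2 * (1 - Γ) - (1 - s) ^ 2 * Γ := by
    have h1 : 0 ≤ 3 * (1 - a * q) * (1 - s) * Γ := by positivity
    have e : (a * q) * (3 * s ^ 2 * (1 - Γ) - (1 - s) ^ 2 * Γ)
        = 3 * (a * q) * s ^ 2 * (1 - Γ) - (3 * (1 - a * q) * (1 - s) + (a * q) * (1 - s) ^ 2) * Γ + 3 * (1 - a * q) * (1 - s) * Γ := by ring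
    have h2 : 0 ≤ (a * q) * (3 * s ^ 2 * (1 - Γ) - (1 - s) ^ 2 * Γ) := by rw [e]; linarith
    exact (mul_nonneg_iff_of_pos_left (mul_pos ha0 hq0)).1 h2
  have hPq : (3 * (1 - a * q) * (1 - s) + q * (1 - s) ^ 2) * Γ ≤ 3 * q * s ^ 2 * (1 - Γ) := by
    have h1 := mul_le_mul_of_nonneg_right hqa hB
    nlinarith [h1, hP]
  have hqE : (1 - q) ≤ (1 - a * q) + a * (1 - q) := by nlinarith
  have key : (3 * (1 - q) * (1 - a * q) * (1 - s) + q * (1 - s) ^ 2 * ((1 - a * q) + a * (1 - q))) * Γ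
      ≤ 3 * q * s ^ 2 * ((1 - a * q) + a * (1 - q)) * (1 - Γ) := by
    have h1 : 3 * (1 - q) * (1 - a * q) * (1 - s) ≤ 3 * ((1 - a * q) + a * (1 - q)) * (1 - a * q) * (1 - s) := by
      have := mul_le_mul_of_nonneg_right hqE (mul_nonneg h1aq.le (sub_nonneg.2 hs1.le))
      nlinarith
    have h2 : (3 * (1 - q) * (1 - a * q) * (1 - s) + q * (1 - s) ^ 2 * ((1 - a * q) + a * (1 - q))) * Γ
        ≤ ((1 - a * q) + a * (1 - q)) * ((3 * (1 - a * q) * (1 - s) + q * (1 - s) ^ 2) * Γ) := by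
      have := mul_le_mul_of_nonneg_right h1 hΓ0
      nlinarith
    have h3 := mul_le_mul_of_nonneg_left hPq hE.le
    nlinarith
  have hC : 0 ≤ a * q * (1 - s) / (2 - q - a * q) := div_nonneg (by positivity) hD.le
  have hmul := mul_le_mul_of_nonneg_left key hC
  calc (3 * a * q * (1 - q) * (1 - a * q) * (1 - s) ^ 2 / (2 - q - a * q)
        + a * q ^ 2 * (1 - s) ^ 3 * ((1 - a * q) + a * (1 - q)) / (2 - q - a * q)) * Γ
      = a * q * (1 - s) / (2 - q - a * q)
          * ((3 * (1 - q) * (1 - a * q) * (1 - s) + q * (1 - s) ^ 2 * ((1 - a * q) + a * (1 - q))) * Γ) := by ring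
    _ ≤ a * q * (1 - s) / (2 - q - a * q) * (3 * q * s ^ 2 * ((1 - a * q) + a * (1 - q)) * (1 - Γ)) := hmul
    _ = 3 * a * q ^ 2 * s ^ 2 * (1 - s) * ((1 - a * q) + a * (1 - q)) / (2 - q - a * q) * (1 - Γ) := by ring

end LawDec
end Quant
end Summit.CriticalPhenomena.PercolationContinuityZ3.Theorems
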